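import Summits.AtomisticToContinuum.BoseEinsteinCondensation.Theorems.BECCutLineWeakDisorderTwoReplicaTransienceBoundFactorisation
import Summits.AtomisticToContinuum.BoseEinsteinCondensation.Theorems.BECCutLineWeakDisorderTwoReplicaTransienceBoundTracerMeasurable
import Summits.AtomisticToContinuum.BoseEinsteinCondensation.Theorems.BECCutLineWeakDisorderTwoReplicaTransienceBoundFreeGas
import Summits.AtomisticToContinuum.BoseEinsteinCondensation.Theorems.TwoReplicaTransienceBound.Negative.ConstantAtLeastOne
import Mathlib.MeasureTheory.Group.LIntegral
import HarnessLib

/-!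
# Crux `TwoReplicaTransienceBound` (stmt-AtomisticToContinuum-9687), line `SketchIdeator1` v6:
# the insertion step for bounded-integrable pair potentials (stub `stub_insertionStepBounded`)

Support file (`--supports stmt-AtomisticToContinuum-9687`; does not close the item). At a fixed box
`Λ_L = (0,L)³` and `T ≥ 0`, with `t = 2T`, `N_k = ‖e^{-TH_k}1‖₂² = ∫Z^{(k)}_t` (`fkNormSq_eq`) and
`Θ = ‖e^{-TΔ_D}1‖₂² = ∫θ_t` (one free line): `Θ · N_{n+1} ≤ N_{n+2} + (n+1) · L³ · (2T‖v‖₁) · N_n`,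
`‖v‖₁ = ∫_{ℝ³} v(|y|) dy`. Steps: the tangent bound `1 ≤ e^{-a} + a` (`one_le_expNeg_add`) integrated over
the tagged sample, `θ_t(x) ≤ tracer + E_{ω₀}[tagged–bath action]` (`fkPartition_one_le_tracer_add`); against
the bath weight, by the factorisation `Z(x::Y) = ∫ w·tracer` (`stub_factorisation`),
`θ_t(x) Z_{n+1}(Y) ≤ Z_{n+2}(x::Y) + ∫ w E_{ω₀}[action]` (`mul_fkPartition_le`); the error, integrated over
the bath, is `≤ (n+1) t ‖v‖₁ ∫Z_n` uniformly in `x` (`lintegral_error_le`: Tonelli with tagged sample, time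
and bath index outside, and for each bath line `∫∫ w v(|p - B^j_s|) ≤ ‖v‖₁ ∫Z_n` — relabel `j ↦ 0`, split
line `0` off `(ℝ³)^{n+1} ≅ ℝ³ × (ℝ³)ⁿ`, `W_{n+1} ≅ W_1 ⊗ W_n`, drop it from the weight, translation invariance
of Lebesgue measure: `lintegral_fkWeight_mul_le`); from `x ∉ Λ_L` nothing survives, so the `x`-integral of
the error costs `|Λ_L| = L³` (`main_ineq`).

References: B. Simon, *Schrödinger semigroups*, Bull. AMS 7 (1982), §A1 (A7) [Simon1982]; K. L. Chung,
Z. Zhao, *From Brownian Motion to Schrödinger's Equation* (1995), §3.2–3.3 [ChungZhao1995].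
-/

noncomputable section

namespace Summit.AtomisticToContinuum.BoseEinsteinCondensation.Cruxes.TwoReplicaTransienceBound.InsertionBounded

open MeasureTheory Filter Set
open scoped ENNReal NNReal Topology BigOperators
open Literature.MathematicalPhysics.QuantumManyBody.BoseGas
open Literature.Probability.Process (brownian measurable_brownian)
open Summit.AtomisticToContinuum.BoseEinsteinCondensation.Cruxes.TwoReplicaTransienceBound.TracerDecoupling

variable {N n : ℕ}

/-! ### The tangent bound and the pathwise insertion inequality -/

/-- The tangent bound `1 ≤ e^{-a} + a` on `[0, ∞]`. -/
theorem one_le_expNeg_add (a : ℝ≥0∞) : 1 ≤ expNeg a + a := by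
  unfold expNeg
  split_ifs with h
  · rw [h, zero_add]; exact le_top
  · calc (1 : ℝ≥0∞) = ENNReal.ofReal 1 := ENNReal.ofReal_one.symm
      _ ≤ ENNReal.ofReal (Real.exp (-a.toReal) + a.toReal) :=
          ENNReal.ofReal_le_ofReal (by linarith [Real.add_one_le_exp (-a.toReal)])
      _ = ENNReal.ofReal (Real.exp (-a.toReal)) + a := by
          rw [ENNReal.ofReal_add (Real.exp_pos _).le ENNReal.toReal_nonneg, ENNReal.ofReal_toReal h]

/-- **Insertion inequality for one tagged line** (the tangent bound integrated over the tagged sample):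
the free survival probability `θ_t(x) = tracer 0` is at most the tracer among the frozen bath plus the mean
tagged–bath action. -/
theorem fkPartition_one_le_tracer_add {v : ℝ → ℝ≥0∞} (hv : Measurable v) (L t : ℝ) (x : Space)
    (Y : Config n) (ωb : PathSpace n) :
    fkPartition (N := 1) (fun _ => 0) L t (fun _ => x) ≤
      tracer v L t x Y ωb + ∫⁻ ω₀, taggedBathAction v t x Y ω₀ ωb ∂wienerLine := by
  have hm : Measurable fun ω₀ => taggedBathAction v t x Y ω₀ ωb := by
    have h := (TracerMeasurability.measurable_taggedBathAction hv t Y).comp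
      (measurable_prodMk_left (x := (x, ωb)))
    exact h
  rw [← FreeGas.tracer_free_eq_fkPartition L t x Y ωb, tracer_def, tracer_def, ← lintegral_add_right _ hm]
  refine lintegral_mono fun ω₀ => ?_
  rw [taggedBathAction_zero, expNeg_zero, mul_one]
  by_cases h : (fun _ : Fin 1 => ω₀) ∈ survives (N := 1) L t (fun _ => x)
  · rw [Set.indicator_of_mem h, one_mul]
    exact one_le_expNeg_add _
  · rw [Set.indicator_of_notMem h, zero_mul, zero_add]
    exact bot_le

/-- `Z_t(Y) = ∫ fkWeight v L t Y dW`. -/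
theorem fkPartition_eq_lintegral_fkWeight (v : ℝ → ℝ≥0∞) (L t : ℝ) (Y : Config n) :
    fkPartition v L t Y = ∫⁻ ωb, fkWeight v L t Y ωb ∂wienerPaths n := by
  simp only [fkPartition, fkSemigroup, mul_one]

/-- **Insertion inequality against the bath weight**: `θ_t(x) · Z_n(Y) ≤ Z_{n+1}(x::Y) + error`, the error
being the bath-weighted mean tagged–bath action (factorisation of `Z(x::Y)` through the tracer). -/
theorem mul_fkPartition_le {v : ℝ → ℝ≥0∞} (hv : Measurable v) (L t : ℝ) (x : Space) (Y : Config n) :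
    fkPartition (N := 1) (fun _ => 0) L t (fun _ => x) * fkPartition v L t Y ≤
      fkPartition v L t (Matrix.vecCons x Y) +
        ∫⁻ ωb, fkWeight v L t Y ωb * ∫⁻ ω₀, taggedBathAction v t x Y ω₀ ωb ∂wienerLine ∂wienerPaths n := by
  have htr : Measurable fun ωb => tracer v L t x Y ωb := by
    have h := (stub_tracerMeasurable n v hv L t Y).comp (measurable_prodMk_left (x := x))
    exact h
  have hm : Measurable fun ωb => fkWeight v L t Y ωb * tracer v L t x Y ωb :=
    (measurable_fkWeight hv L t Y).mul htr
  rw [stub_factorisation n v hv L t x Y, fkPartition_eq_lintegral_fkWeight v L t Y,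
    ← lintegral_const_mul' _ _ (fkPartition_ne_top _ L t _), ← lintegral_add_left hm]
  refine lintegral_mono fun ωb => ?_
  calc fkPartition (N := 1) (fun _ => 0) L t (fun _ => x) * fkWeight v L t Y ωb
      = fkWeight v L t Y ωb * fkPartition (N := 1) (fun _ => 0) L t (fun _ => x) := mul_comm _ _
    _ ≤ fkWeight v L t Y ωb * (tracer v L t x Y ωb + ∫⁻ ω₀, taggedBathAction v t x Y ω₀ ωb ∂wienerLine) :=
        mul_le_mul' le_rfl (fkPartition_one_le_tracer_add hv L t x Y ωb)
    _ = _ := mul_add _ _ _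

/-! ### Relabelling the bath lines -/

/-- Relabelled world-lines: `B(X ∘ σ, ω ∘ σ) = B(X, ω) ∘ σ`. -/
theorem worldLine_relabel (σ : Equiv.Perm (Fin N)) (X : Config N) (ω : PathSpace N) (s : ℝ≥0) :
    worldLine (X ∘ σ) (fun i => ω (σ i)) s = worldLine X ω s ∘ σ := rfl

/-- The survival event is invariant under relabelling. -/
theorem relabel_mem_survives_iff (σ : Equiv.Perm (Fin N)) (L T : ℝ) (X : Config N) (ω : PathSpace N) :
    (fun i => ω (σ i)) ∈ survives L T (X ∘ σ) ↔ ω ∈ survives L T X := by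
  have hb : ∀ Y : Config N, Y ∘ σ ∈ boxN N L ↔ Y ∈ boxN N L := fun Y =>
    ⟨fun h i => by simpa using h (σ.symm i), fun h i => h (σ i)⟩
  simp only [survives, Set.mem_setOf_eq, worldLine_relabel, hb]

/-- The Feynman–Kac weight is invariant under relabelling (`interaction_comp_perm`). -/
theorem fkWeight_relabel (σ : Equiv.Perm (Fin N)) (v : ℝ → ℝ≥0∞) (L T : ℝ) (X : Config N) (ω : PathSpace N) :
    fkWeight v L T (X ∘ σ) (fun i => ω (σ i)) = fkWeight v L T X ω := by
  have ha : pathAction v T (X ∘ σ) (fun i => ω (σ i)) = pathAction v T X ω := by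
    simp only [pathAction, worldLine_relabel, interaction_comp_perm]
  simp only [fkWeight]
  by_cases hω : ω ∈ survives L T X
  · rw [Set.indicator_of_mem hω, Set.indicator_of_mem ((relabel_mem_survives_iff σ L T X ω).2 hω), ha]
  · rw [Set.indicator_of_notMem hω,
      Set.indicator_of_notMem (fun h => hω ((relabel_mem_survives_iff σ L T X ω).1 h))]

/-- Relabelling the particles preserves `dY ⊗ dW_N` on (bath slice, bath sample) (both factors are products
of identical laws: `volume_measurePreserving_piCongrLeft`, `measurePreserving_comp_perm_wienerPaths`). -/
theorem measurePreserving_relabel (σ : Equiv.Perm (Fin N)) :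
    MeasurePreserving (Prod.map (fun (Y : Config N) => Y ∘ σ) (fun (ω : PathSpace N) (i : Fin N) => ω (σ i)))
      ((volume : Measure (Config N)).prod (wienerPaths N)) ((volume : Measure (Config N)).prod (wienerPaths N)) := by
  have h := (volume_measurePreserving_piCongrLeft (fun _ : Fin N => Space) σ).symm _
  have e : ⇑(MeasurableEquiv.piCongrLeft (fun _ : Fin N => Space) σ).symm = fun (Y : Config N) => Y ∘ σ := by
    funext Y i
    simp [MeasurableEquiv.piCongrLeft, Equiv.piCongrLeft_symm_apply]
  rw [e] at h
  exact h.prod (measurePreserving_comp_perm_wienerPaths σ)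

/-! ### The bath integral of the weight against one term of the tagged–bath potential -/

/-- Joint measurability of `(Y, ωb) ↦ w(Y, ωb) · v(|p - B^j_s(Y, ωb)|)`. -/
theorem measurable_fkWeight_mul {v : ℝ → ℝ≥0∞} (hv : Measurable v) (L t : ℝ) (p : Space) (s : ℝ≥0) (j : Fin N) :
    Measurable fun b : Config N × PathSpace N => fkWeight v L t b.1 b.2 * v (dist p (worldLine b.1 b.2 s j)) :=
  (measurable_fkWeight_uncurry hv L t).mul
    (hv.comp (measurable_const.dist ((measurable_pi_apply j).comp (measurable_worldLine_uncurry' s))))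

/-- **Dropping the tagged bath line**: for line `0` of an `(n+1)`-line bath,
`∫∫ w(Y, ωb) v(|p - B⁰_s|) dW dY ≤ ‖v‖₁ · ∫ Z_n` — split line `0` off (`(ℝ³)^{n+1} ≅ ℝ³ × (ℝ³)ⁿ`,
`W_{n+1} ≅ W_1 ⊗ W_n`), bound the weight by the weight of the other `n` lines (`fkWeight_vecCons_cons`), and
integrate the starting point of line `0` by translation invariance of Lebesgue measure. -/
theorem lintegral_fkWeight_mul_zero_le {v : ℝ → ℝ≥0∞} (hv : Measurable v) (L t : ℝ) (p : Space) (s : ℝ≥0) :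
    ∫⁻ b, fkWeight v L t b.1 b.2 * v (dist p (worldLine b.1 b.2 s 0))
        ∂((volume : Measure (Config (n + 1))).prod (wienerPaths (n + 1))) ≤
      (∫⁻ y : Space, v ‖y‖) * ∫⁻ Y' : Config n, fkPartition v L t Y' := by
  -- the displaced potential seen from the starting point `y` of line `0`, along its sample `ω`
  obtain ⟨f, hf⟩ : ∃ f : Space → (Fin 3 → (ℝ≥0 → ℝ)) → ℝ≥0∞, ∀ y ω,
      f y ω = v (dist p (y + WithLp.toLp 2 (fun k => Real.sqrt 2 * brownian s (ω k)))) := ⟨_, fun _ _ => rfl⟩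
  have hq : Measurable fun ω : Fin 3 → (ℝ≥0 → ℝ) => WithLp.toLp 2 (fun k => Real.sqrt 2 * brownian s (ω k)) :=
    (WithLp.measurable_toLp 2 _).comp (measurable_pi_lambda _ fun k =>
      measurable_const.mul ((measurable_brownian s).comp (measurable_pi_apply k)))
  have hfm : Measurable (Function.uncurry f) := by
    rw [show Function.uncurry f = fun z => v (dist p (z.1 + WithLp.toLp 2
        (fun k => Real.sqrt 2 * brownian s (z.2 k)))) from funext fun z => hf z.1 z.2]
    exact hv.comp (measurable_const.dist (measurable_fst.add (hq.comp measurable_snd)))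
  -- translation invariance of Lebesgue measure in the starting point of line `0`
  have htrans : ∀ ω, ∫⁻ y, f y ω = ∫⁻ y : Space, v ‖y‖ := fun ω => by
    have : ∀ y, f y ω =
        (fun z : Space => v ‖z‖) ((WithLp.toLp 2 (fun k => Real.sqrt 2 * brownian s (ω k)) - p) + y) := fun y => by
      rw [hf, dist_eq_norm, ← norm_neg]
      congr 2
      abel
    simp_rw [this]
    exact lintegral_add_left_eq_self (μ := volume) (fun z : Space => v ‖z‖) _
  -- split line `0` off the bath sample and drop it from the weight
  have hsplit : ∀ (y : Space) (Y' : Config n),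
      ∫⁻ ωb, fkWeight v L t (Matrix.vecCons y Y') ωb * v (dist p (worldLine (Matrix.vecCons y Y') ωb s 0))
        ∂wienerPaths (n + 1) ≤ fkPartition v L t Y' * ∫⁻ ω, f y ω ∂wienerLine := by
    intro y Y'
    set e := MeasurableEquiv.piFinSuccAbove (fun _ : Fin (n + 1) => Fin 3 → (ℝ≥0 → ℝ)) 0 with he
    have hmp : MeasurePreserving e (wienerPaths (n + 1)) (wienerLine.prod (wienerPaths n)) :=
      TracerFactorisation.measurePreserving_piFinSuccAbove_wienerPaths n
    have hF₀ : Measurable fun ωb : PathSpace (n + 1) =>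
        fkWeight v L t (Matrix.vecCons y Y') ωb * v (dist p (worldLine (Matrix.vecCons y Y') ωb s 0)) :=
      (measurable_fkWeight hv L t _).mul
        (hv.comp (measurable_const.dist ((measurable_pi_apply 0).comp (measurable_worldLine _ s))))
    have hF : Measurable fun q : (Fin 3 → (ℝ≥0 → ℝ)) × PathSpace n =>
        fkWeight v L t (Matrix.vecCons y Y') (e.symm q) * v (dist p (worldLine (Matrix.vecCons y Y') (e.symm q) s 0)) :=
      hF₀.comp e.symm.measurable
    have hw : Measurable fun ωb' => fkWeight v L t Y' ωb' := measurable_fkWeight hv L t Y'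
    rw [← hmp.symm.lintegral_comp_emb e.symm.measurableEmbedding, lintegral_prod _ hF.aemeasurable,
      ← lintegral_const_mul' _ _ (fkPartition_ne_top v L t Y')]
    refine lintegral_mono fun ω => ?_
    rw [fkPartition_eq_lintegral_fkWeight v L t Y', ← lintegral_mul_const _ hw]
    refine lintegral_mono fun ωb' => ?_
    simp only [he, TracerFactorisation.piFinSuccAbove_symm_apply_eq_cons, TracerFactorisation.fkWeight_vecCons_cons hv,
      TracerFactorisation.worldLine_vecCons_cons_zero, hf]
    have h1 : (survives (N := 1) L t (fun _ => y)).indicator (fun _ => (1 : ℝ≥0∞)) (fun _ => ω) *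
        expNeg (taggedBathAction v t y Y' ω ωb') ≤ 1 :=
      mul_le_one' (Set.indicator_apply_le' (fun _ => le_rfl) (fun _ => zero_le_one)) (expNeg_le_one _)
    exact mul_le_mul' (mul_le_of_le_one_right' h1) le_rfl
  have hG : Measurable fun b : Config (n + 1) × PathSpace (n + 1) =>
      fkWeight v L t b.1 b.2 * v (dist p (worldLine b.1 b.2 s 0)) := measurable_fkWeight_mul hv L t p s 0
  have hZ : Measurable fun Y' : Config n => fkPartition v L t Y' := measurable_fkSemigroup hv L t measurable_const
  have hI : Measurable fun y : Space => ∫⁻ ω, f y ω ∂wienerLine := hfm.lintegral_prod_right'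
  calc ∫⁻ b, fkWeight v L t b.1 b.2 * v (dist p (worldLine b.1 b.2 s 0))
        ∂((volume : Measure (Config (n + 1))).prod (wienerPaths (n + 1)))
      = ∫⁻ Y, ∫⁻ ωb, fkWeight v L t Y ωb * v (dist p (worldLine Y ωb s 0)) ∂wienerPaths (n + 1) :=
        lintegral_prod _ hG.aemeasurable
    _ = ∫⁻ y, ∫⁻ Y' : Config n, ∫⁻ ωb, fkWeight v L t (Matrix.vecCons y Y') ωb *
          v (dist p (worldLine (Matrix.vecCons y Y') ωb s 0)) ∂wienerPaths (n + 1) :=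
        (lintegral_lintegral_vecCons hG.lintegral_prod_right').symm
    _ ≤ ∫⁻ y, ∫⁻ Y' : Config n, fkPartition v L t Y' * ∫⁻ ω, f y ω ∂wienerLine :=
        lintegral_mono fun y => lintegral_mono fun Y' => hsplit y Y'
    _ = ∫⁻ y, (∫⁻ Y' : Config n, fkPartition v L t Y') * ∫⁻ ω, f y ω ∂wienerLine :=
        lintegral_congr fun y => lintegral_mul_const _ hZ
    _ = (∫⁻ Y' : Config n, fkPartition v L t Y') * ∫⁻ y, ∫⁻ ω, f y ω ∂wienerLine := lintegral_const_mul _ hI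
    _ = (∫⁻ Y' : Config n, fkPartition v L t Y') * ∫⁻ y : Space, v ‖y‖ := by
        rw [lintegral_lintegral_swap hfm.aemeasurable]
        simp_rw [htrans]
        rw [lintegral_const, measure_univ, mul_one]
    _ = _ := mul_comm _ _

/-- **The bath integral of the weight against one term of the tagged–bath potential**: for every bath line
`j`, point `p` and time `s`, `∫∫ w(Y, ωb) v(|p - B^j_s|) dW dY ≤ ‖v‖₁ · ∫ Z_n` (relabel `j ↦ 0`, measure
preserving, then `lintegral_fkWeight_mul_zero_le`). -/
theorem lintegral_fkWeight_mul_le {v : ℝ → ℝ≥0∞} (hv : Measurable v) (L t : ℝ) (p : Space) (s : ℝ≥0)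
    (j : Fin (n + 1)) :
    ∫⁻ b, fkWeight v L t b.1 b.2 * v (dist p (worldLine b.1 b.2 s j))
        ∂((volume : Measure (Config (n + 1))).prod (wienerPaths (n + 1))) ≤
      (∫⁻ y : Space, v ‖y‖) * ∫⁻ Y' : Config n, fkPartition v L t Y' := by
  have h := (measurePreserving_relabel (N := n + 1) (Equiv.swap 0 j)).lintegral_comp
    (measurable_fkWeight_mul hv L t p s 0)
  simp only [Prod.map_fst, Prod.map_snd, fkWeight_relabel, worldLine_relabel, Function.comp_apply,
    Equiv.swap_apply_left] at h
  calc _ = _ := h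
    _ ≤ _ := lintegral_fkWeight_mul_zero_le hv L t p s

/-! ### The error term -/

/-- **The error term is bounded uniformly in the tagged starting point**:
`∫ dY ∫ dW w(Y,ωb) E_{ω₀}[tagged–bath action] ≤ (n+1) · ‖v‖₁ · (∫ Z_n) · t` (Tonelli: tagged sample, time and
bath index outside; `lintegral_fkWeight_mul_le` inside). -/
theorem lintegral_error_le {v : ℝ → ℝ≥0∞} (hv : Measurable v) (L t : ℝ) (x : Space) :
    ∫⁻ Y : Config (n + 1), ∫⁻ ωb, fkWeight v L t Y ωb *
        ∫⁻ ω₀, taggedBathAction v t x Y ω₀ ωb ∂wienerLine ∂wienerPaths (n + 1) ≤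
      ((n + 1 : ℕ) : ℝ≥0∞) * ((∫⁻ y : Space, v ‖y‖) * ∫⁻ Y' : Config n, fkPartition v L t Y') * ENNReal.ofReal t := by
  -- the summands of the tagged–bath integrand, as functions of `((Y, ωb), (ω₀, s))`
  obtain ⟨G, hG⟩ : ∃ G : Fin (n + 1) → (Config (n + 1) × PathSpace (n + 1)) × ((Fin 3 → (ℝ≥0 → ℝ)) × ℝ) → ℝ≥0∞,
      ∀ j q, G j q = v (dist (worldLine (Matrix.vecCons x q.1.1) (Fin.cons q.2.1 q.1.2) q.2.2.toNNReal 0)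
        (worldLine (Matrix.vecCons x q.1.1) (Fin.cons q.2.1 q.1.2) q.2.2.toNNReal j.succ)) := ⟨_, fun _ _ => rfl⟩
  have hWL : Measurable fun q : (Config (n + 1) × PathSpace (n + 1)) × ((Fin 3 → (ℝ≥0 → ℝ)) × ℝ) =>
      worldLine (Matrix.vecCons x q.1.1) (Fin.cons q.2.1 q.1.2) q.2.2.toNNReal :=
    TracerMeasurability.measurable_worldLine_param
      (measurable_vecCons_prod.comp (measurable_const.prodMk (measurable_fst.comp measurable_fst)))
      (TracerMeasurability.measurable_finCons (measurable_fst.comp measurable_snd) (measurable_snd.comp measurable_fst))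
      (measurable_snd.comp measurable_snd)
  have hGm : ∀ j, Measurable (G j) := fun j => by
    rw [show G j = _ from funext (hG j)]
    exact hv.comp (((measurable_pi_apply 0).comp hWL).dist ((measurable_pi_apply j.succ).comp hWL))
  have hSm : Measurable fun q : (Config (n + 1) × PathSpace (n + 1)) × ((Fin 3 → (ℝ≥0 → ℝ)) × ℝ) => ∑ j, G j q :=
    Finset.measurable_sum _ fun j _ => hGm j
  have hW : Measurable fun b : Config (n + 1) × PathSpace (n + 1) => fkWeight v L t b.1 b.2 :=
    measurable_fkWeight_uncurry hv L t
  have hWS : Measurable fun q : (Config (n + 1) × PathSpace (n + 1)) × ((Fin 3 → (ℝ≥0 → ℝ)) × ℝ) =>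
      fkWeight v L t q.1.1 q.1.2 * ∑ j, G j (q.1, q.2) :=
    (hW.comp measurable_fst).mul (hSm.comp (measurable_fst.prodMk measurable_snd))
  -- the mean tagged–bath action as an integral over (tagged sample, time)
  have hA : ∀ (Y : Config (n + 1)) (ωb : PathSpace (n + 1)), ∫⁻ ω₀, taggedBathAction v t x Y ω₀ ωb ∂wienerLine =
      ∫⁻ c, ∑ j, G j ((Y, ωb), c) ∂(wienerLine.prod (volume.restrict (Set.Ioc 0 t))) := by
    intro Y ωb
    have hm : Measurable fun c : (Fin 3 → (ℝ≥0 → ℝ)) × ℝ => ∑ j, G j ((Y, ωb), c) := hSm.comp measurable_prodMk_left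
    rw [lintegral_prod _ hm.aemeasurable]
    simp only [hG, taggedBathAction]
  have hγ : (wienerLine.prod (volume.restrict (Set.Ioc 0 t))) Set.univ = ENNReal.ofReal t := by
    rw [← Set.univ_prod_univ, Measure.prod_prod, measure_univ, one_mul, Measure.restrict_apply_univ,
      Real.volume_Ioc, sub_zero]
  calc ∫⁻ Y : Config (n + 1), ∫⁻ ωb, fkWeight v L t Y ωb *
          ∫⁻ ω₀, taggedBathAction v t x Y ω₀ ωb ∂wienerLine ∂wienerPaths (n + 1)
      = ∫⁻ Y : Config (n + 1), ∫⁻ ωb, fkWeight v L t Y ωb *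
          ∫⁻ c, ∑ j, G j ((Y, ωb), c) ∂(wienerLine.prod (volume.restrict (Set.Ioc 0 t))) ∂wienerPaths (n + 1) :=
        lintegral_congr fun Y => lintegral_congr fun ωb => by rw [hA]
    _ = ∫⁻ b, fkWeight v L t b.1 b.2 * ∫⁻ c, ∑ j, G j (b, c) ∂(wienerLine.prod (volume.restrict (Set.Ioc 0 t)))
          ∂(volume.prod (wienerPaths (n + 1))) :=
        (lintegral_prod _ (hW.mul hSm.lintegral_prod_right').aemeasurable).symm
    _ = ∫⁻ b, ∫⁻ c, fkWeight v L t b.1 b.2 * ∑ j, G j (b, c) ∂(wienerLine.prod (volume.restrict (Set.Ioc 0 t)))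
          ∂(volume.prod (wienerPaths (n + 1))) :=
        lintegral_congr fun b => (lintegral_const_mul' _ _ ((fkWeight_le_one v L t _ _).trans_lt ENNReal.one_lt_top).ne).symm
    _ = ∫⁻ c, ∫⁻ b, fkWeight v L t b.1 b.2 * ∑ j, G j (b, c) ∂(volume.prod (wienerPaths (n + 1)))
          ∂(wienerLine.prod (volume.restrict (Set.Ioc 0 t))) := lintegral_lintegral_swap hWS.aemeasurable
    _ = ∫⁻ c, ∑ j, ∫⁻ b, fkWeight v L t b.1 b.2 * G j (b, c) ∂(volume.prod (wienerPaths (n + 1)))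
          ∂(wienerLine.prod (volume.restrict (Set.Ioc 0 t))) := by
        refine lintegral_congr fun c => ?_
        have hj : ∀ j, Measurable fun b : Config (n + 1) × PathSpace (n + 1) => fkWeight v L t b.1 b.2 * G j (b, c) :=
          fun j => hW.mul ((hGm j).comp measurable_prodMk_right)
        simp only [Finset.mul_sum]
        exact lintegral_finsetSum _ fun j _ => hj j
    _ ≤ ∫⁻ c, ∑ j : Fin (n + 1), ((∫⁻ y : Space, v ‖y‖) * ∫⁻ Y' : Config n, fkPartition v L t Y')
          ∂(wienerLine.prod (volume.restrict (Set.Ioc 0 t))) := by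
        refine lintegral_mono fun c => Finset.sum_le_sum fun j _ => ?_
        calc ∫⁻ b, fkWeight v L t b.1 b.2 * G j (b, c) ∂(volume.prod (wienerPaths (n + 1)))
            = ∫⁻ b, fkWeight v L t b.1 b.2 * v (dist (x + WithLp.toLp 2 (fun k => Real.sqrt 2 * brownian c.2.toNNReal (c.1 k)))
                (worldLine b.1 b.2 c.2.toNNReal j)) ∂(volume.prod (wienerPaths (n + 1))) :=
              lintegral_congr fun b => by
                simp only [hG, TracerFactorisation.worldLine_vecCons_cons_zero, TracerFactorisation.worldLine_vecCons_cons_succ]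
          _ ≤ _ := lintegral_fkWeight_mul_le hv L t _ _ j
    _ = _ := by rw [lintegral_const, Finset.sum_const, Finset.card_univ, Fintype.card_fin, nsmul_eq_mul, hγ]

/-! ### The insertion step at a fixed box and time -/

/-- **The insertion step** at a fixed box `Λ_L` and length `t ≥ 0`, in partition-function form:
`(∫θ_t) · ∫Z^{(n+1)}_t ≤ ∫Z^{(n+2)}_t + (n+1) · L³ · (t‖v‖₁) · ∫Z^{(n)}_t` (insertion inequality slice by slice
and the uniform error bound for `x ∈ Λ_L`; from `x ∉ Λ_L` nothing survives; Fubini over the first particle). -/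
theorem main_ineq {v : ℝ → ℝ≥0∞} (hv : Measurable v) {L : ℝ} (hL : 0 < L) {t : ℝ} (ht : 0 ≤ t) :
    (∫⁻ x : Space, fkPartition (N := 1) (fun _ => 0) L t (fun _ => x)) * ∫⁻ Y : Config (n + 1), fkPartition v L t Y ≤
      (∫⁻ X : Config (n + 2), fkPartition v L t X) +
        ((n : ℝ≥0∞) + 1) * ENNReal.ofReal (L ^ 3) * (ENNReal.ofReal t * ∫⁻ y : Space, v ‖y‖) *
          ∫⁻ Y' : Config n, fkPartition v L t Y' := by
  set K : ℝ≥0∞ := ((n + 1 : ℕ) : ℝ≥0∞) * ((∫⁻ y : Space, v ‖y‖) * ∫⁻ Y' : Config n, fkPartition v L t Y') *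
    ENNReal.ofReal t with hK
  have hθm : Measurable fun x : Space => fkPartition (N := 1) (fun _ => 0) L t (fun _ => x) :=
    FreeGas.measurable_fkPartition_one measurable_const L t
  have hZ : Measurable fun X : Config (n + 2) => fkPartition v L t X := measurable_fkSemigroup hv L t measurable_const
  have hZx : ∀ x : Space, Measurable fun Y : Config (n + 1) => fkPartition v L t (Matrix.vecCons x Y) :=
    fun x => hZ.comp (measurable_vecCons_right x)
  have hZY : Measurable fun x : Space => ∫⁻ Y : Config (n + 1), fkPartition v L t (Matrix.vecCons x Y) :=
    (hZ.comp measurable_vecCons_prod).lintegral_prod_right'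
  -- slice by slice
  have hpt : ∀ x : Space, fkPartition (N := 1) (fun _ => 0) L t (fun _ => x) * ∫⁻ Y : Config (n + 1), fkPartition v L t Y ≤
      (∫⁻ Y : Config (n + 1), fkPartition v L t (Matrix.vecCons x Y)) + (box L).indicator (fun _ => K) x := by
    intro x
    by_cases hx : x ∈ box L
    · rw [Set.indicator_of_mem hx, ← lintegral_const_mul' _ _ (fkPartition_ne_top _ L t _)]
      calc ∫⁻ Y : Config (n + 1), fkPartition (N := 1) (fun _ => 0) L t (fun _ => x) * fkPartition v L t Y
          ≤ ∫⁻ Y : Config (n + 1), (fkPartition v L t (Matrix.vecCons x Y) + ∫⁻ ωb, fkWeight v L t Y ωb *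
              ∫⁻ ω₀, taggedBathAction v t x Y ω₀ ωb ∂wienerLine ∂wienerPaths (n + 1)) :=
            lintegral_mono fun Y => mul_fkPartition_le hv L t x Y
        _ = (∫⁻ Y : Config (n + 1), fkPartition v L t (Matrix.vecCons x Y)) + ∫⁻ Y : Config (n + 1), ∫⁻ ωb,
              fkWeight v L t Y ωb * ∫⁻ ω₀, taggedBathAction v t x Y ω₀ ωb ∂wienerLine ∂wienerPaths (n + 1) :=
            lintegral_add_left (hZx x) _
        _ ≤ _ := add_le_add le_rfl (lintegral_error_le hv L t x)
    · have h0 : fkPartition (N := 1) (fun _ => 0) L t (fun _ => x) = 0 := fkSemigroup_of_notMem _ ht _ fun h => hx (h 0)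
      rw [h0, zero_mul]
      exact bot_le
  calc (∫⁻ x : Space, fkPartition (N := 1) (fun _ => 0) L t (fun _ => x)) * ∫⁻ Y : Config (n + 1), fkPartition v L t Y
      = ∫⁻ x : Space, fkPartition (N := 1) (fun _ => 0) L t (fun _ => x) * ∫⁻ Y : Config (n + 1), fkPartition v L t Y :=
        (lintegral_mul_const _ hθm).symm
    _ ≤ ∫⁻ x : Space, ((∫⁻ Y : Config (n + 1), fkPartition v L t (Matrix.vecCons x Y)) + (box L).indicator (fun _ => K) x) :=
        lintegral_mono hpt
    _ = (∫⁻ X : Config (n + 2), fkPartition v L t X) + K * volume (box L) := by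
        rw [lintegral_add_left hZY, lintegral_indicator_const (measurableSet_box L), lintegral_lintegral_vecCons hZ]
    _ = _ := by
        rw [volume_box, ← ENNReal.ofReal_pow hL.le, hK]
        push_cast
        ring

end Summit.AtomisticToContinuum.BoseEinsteinCondensation.Cruxes.TwoReplicaTransienceBound.InsertionBounded

namespace Summit.AtomisticToContinuum.BoseEinsteinCondensation.Cruxes.TwoReplicaTransienceBound.TracerDecoupling

open MeasureTheory
open scoped ENNReal NNReal BigOperators
open Literature.MathematicalPhysics.QuantumManyBody.BoseGas

/-- **Registered toolbox stub `stub_insertionStepBounded`** (crux stmt-AtomisticToContinuum-9687, line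
`SketchIdeator1`, skeleton v6): the insertion step for bounded-integrable `v` —
`Θ · N_{n+1} ≤ N_{n+2} + (n+1) · |Λ_L| · (2T‖v‖₁) · N_n` with `N_k = ‖e^{-TH_k}1‖₂²`, `Θ = ‖e^{-TΔ_D}1‖₂²` (one
free line), `‖v‖₁ = ∫_{ℝ³} v(|y|) dy` (`fkNormSq_eq` to pass to `2T`-partition functions, then
`InsertionBounded.main_ineq`). -/
theorem stub_insertionStepBounded :
    ∀ (n : ℕ) (v : ℝ → ENNReal), Measurable v → ∀ (L T : ℝ), 0 < L → 0 ≤ T →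
      @fkNormSq 1 (fun _ => 0) L T (fun _ => (1 : ENNReal)) *
          @fkNormSq (n + 1) v L T (fun _ => (1 : ENNReal)) ≤
        @fkNormSq (n + 2) v L T (fun _ => (1 : ENNReal)) +
          ((n : ENNReal) + 1) * ENNReal.ofReal (L ^ 3) *
            (ENNReal.ofReal (2 * T) * ∫⁻ y : Space, v ‖y‖) *
            @fkNormSq n v L T (fun _ => (1 : ENNReal)) := by
  intro n v hv L T hL hT
  have hΘ : fkNormSq (N := 1) (fun _ => 0) L T (fun _ => 1) =
      ∫⁻ x : Space, fkPartition (N := 1) (fun _ => 0) L (2 * T) (fun _ => x) := by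
    rw [fkNormSq_eq (N := 1) measurable_const L hT measurable_const, FreeGas.lintegral_config_one]
    simp only [one_mul]
    rfl
  have hN : ∀ m : ℕ, fkNormSq (N := m) v L T (fun _ => 1) = ∫⁻ Y : Config m, fkPartition v L (2 * T) Y := fun m => by
    rw [fkNormSq_eq hv L hT measurable_const]
    simp only [one_mul]
    rfl
  rw [hΘ, hN, hN, hN]
  exact InsertionBounded.main_ineq hv hL (by positivity)

end Summit.AtomisticToContinuum.BoseEinsteinCondensation.Cruxes.TwoReplicaTransienceBound.TracerDecoupling

end
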